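import Summits.Ventures.WeilGRH.ReflectionTransfer
import Summits.Ventures.WeilGRH.ReflectionCriterion
import Literature.NumberTheory.LFunctions.WeilFirstPrimePositivityTwoFifths
import HarnessLib

/-!
# GRH arm (rh-explicit, venture WeilGRH): PROVED rungs from the reflection transfer

Numerical instances of `weilPositivityOnChar_transfer_reflection` at the two `ζ` rungs of the
one-prime window `log 2 < 2a ≤ log 3` that are kernel-checked in the tree
(`weilPositivityOn_log_three_half`, Yoshida's base rung, and `weilPositivityOn_two_fifths`):

* `a = (log 3)/2`: `WeilPositivityOnChar χ ((log 3)/2)` for EVERY Dirichlet character `χ` of EVERY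
  modulus `q ≥ 10` (`OnePrimeTransfer`: `q ≥ 81`); for every character of EVEN modulus `q ≥ 8`
  (`χ(2) = 0`); for `q ≥ 9` when `‖1 − χ(2)‖² ≥ 1` and for `q ≥ 7` when `‖1 − χ(2)‖² ≥ 3` (the
  primitive characters mod `9`, resp. the characters mod `7` with `χ(2)` a primitive cube root of unity).
* `a = 2/5`: the rung for EVERY character mod `q ≥ 6`, and for `q ≥ 5` when `‖1 − χ(2)‖² ≥ 2`
  (the three primitive characters mod `5`: `χ(2) ∈ {i, −1, −i}`).

The closed forms at `a = (log 3)/2` are `C_M = √3/12 + log 2 − (log 3)/2`,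
`C_A = √3/8 + (log 3 − log 2)/2`, `I_A = 3√2(log 3 − log 2)/8 + 1/(2√2√3)` and at `a = 2/5` they are
rational functions of `e^{2/5}`, `√2`, `log 2`; the criterion (affine in `σ = ‖1 − χ(2)‖²` on the
curve `Re(1 − χ(2)) = σ/2`, which is the worst case since `‖χ(2)‖ ≤ 1`) is checked at the endpoints
with rational bounds (`log 2, log 3, log 5` to 9 places from Mathlib, `√2, √3` by squaring,
`e^{2/5}` by `Real.exp_bound`). The margins are ≥ 2 %.

## References

* A. Weil (1952), (11) and the «lemme» p. 262; H. Yoshida (1992), Thm 1.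
-/

noncomputable section

open Complex Filter Set MeasureTheory
open scoped Real Topology ComplexConjugate

namespace Summit.Ventures.WeilGRH

open Literature.NumberTheory.LFunctions

/-! ## The rung `(log 3)/2` -/

variable {q : ℕ}

/-- The rung `(log 3)/2` from the cleared criterion with RATIONAL bounds in place of the closed forms:
for `1 ≤ B ≤ log q`, `σ₀ ≤ ‖1 − χ(2)‖² ≤ σ₁ ≤ 4` and the bounded curve criterion at `σ₀` and `σ₁`,
`WeilPositivityOnChar χ ((log 3)/2)`. [cite: Weil1952FormulesExplicites, the «lemme» p. 262; Yoshida1992, Thm 1] -/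
theorem weilPositivityOnChar_log_three_half_of_curve [NeZero q] (hq1 : q ≠ 1)
    (χ : DirichletCharacter ℂ q) {B σ₀ σ₁ : ℝ} (hBq : B ≤ Real.log q) (hB1 : 1 ≤ B)
    (hσ₀ : σ₀ ≤ ‖1 - χ (2 : ZMod q)‖ ^ 2) (hσ₁ : ‖1 - χ (2 : ZMod q)‖ ^ 2 ≤ σ₁) (hσ₀0 : 0 ≤ σ₀)
    (hσ₁4 : σ₁ ≤ 4)
    (h0 : 2 * (0.28818 * (B ^ 2 - 0.49012 ^ 2 * σ₀) +
        2 * B * (B * 0.41925 - 0.49012 * (σ₀ / 2) * 0.41915)) ≤ B * (B ^ 2 - 0.49014 ^ 2 * σ₀))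
    (h1 : 2 * (0.28818 * (B ^ 2 - 0.49012 ^ 2 * σ₁) +
        2 * B * (B * 0.41925 - 0.49012 * (σ₁ / 2) * 0.41915)) ≤ B * (B ^ 2 - 0.49014 ^ 2 * σ₁)) :
    WeilPositivityOnChar χ (Real.log 3 / 2) := by
  obtain ⟨hCM, hCA, hIA⟩ := log_three_half_constants
  obtain ⟨hk1, hk2⟩ := kprime_bounds
  set k' := Real.log 2 / Real.sqrt 2 with hk'
  set u : ℂ := 1 - χ (2 : ZMod q) with hu
  have hB : 0 < B := by linarith
  have hk0 : 0 ≤ k' := by linarith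
  have hIA0 : (0 : ℝ) ≤ (Real.log 3 / 2 - (Real.log 2 - Real.log 3 / 2)) *
      Real.cosh (Real.log 2 / 2) / 2 + Real.sinh (Real.log 3 / 2 - Real.log 2 / 2) := by linarith
  -- exact criterion at the endpoints, then interpolation
  have hend : ∀ s : ℝ, 0 ≤ s → s ≤ 4 →
      2 * (0.28818 * (B ^ 2 - 0.49012 ^ 2 * s) +
        2 * B * (B * 0.41925 - 0.49012 * (s / 2) * 0.41915)) ≤ B * (B ^ 2 - 0.49014 ^ 2 * s) →
      2 * ((Real.sinh (Real.log 2 - Real.log 3 / 2) + (Real.log 2 - Real.log 3 / 2)) *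
          (B ^ 2 - k' ^ 2 * s) + 2 * B * (B * ((Real.sinh (Real.log 3 / 2) -
          Real.sinh (Real.log 2 - Real.log 3 / 2) + (Real.log 3 / 2 - (Real.log 2 - Real.log 3 / 2))) / 2) -
          k' * (s / 2) * ((Real.log 3 / 2 - (Real.log 2 - Real.log 3 / 2)) *
            Real.cosh (Real.log 2 / 2) / 2 + Real.sinh (Real.log 3 / 2 - Real.log 2 / 2)))) ≤
        B * (B ^ 2 - k' ^ 2 * s) := fun s hs0 hs4 hnum ↦
    reflection_criterion_of_bounds hCM hCA hIA (by norm_num) (by linarith) hs0 hk1 hk2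
      (by norm_num) hB (by norm_num) (by nlinarith) hnum
  have hcrit := reflection_criterion_interpolate (ρ := u.re) hk0 hIA0 hB.le
    (hend σ₀ hσ₀0 (by linarith) h0) (hend σ₁ (by linarith) hσ₁4 h1) hσ₀ hσ₁
    (normSq_one_sub_half_le_re (χ.norm_le_one _))
  have hlog23 : Real.log 2 < Real.log 3 := Real.log_lt_log (by norm_num) (by norm_num)
  refine weilPositivityOnChar_transfer_reflection (B := B) (κ := k' * ‖u‖) (by linarith)
    (le_of_eq (by ring)) weilPositivityOn_log_three_half hq1 χ hBq (by rw [hk', hu]) ?_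
    rfl rfl rfl rfl ?_
  · have h2 : ‖u‖ ≤ 2 := by nlinarith [normSq_one_sub_char_le_four χ, norm_nonneg u]
    nlinarith [norm_nonneg u]
  · rw [mul_pow]
    exact hcrit

/-- **The `ζ` base rung `(log 3)/2` holds for EVERY Dirichlet character of EVERY modulus `q ≥ 10`**:
`WeilPositivityOnChar χ ((log 3)/2)` (reflection transfer with `B = 23/10 ≤ log 10`; curve endpoints
`σ = 0`: `2(sinh a + a) = 2.2533 ≤ 2.3`, and `σ = 4`). Supersedes `OnePrimeTransfer`'s `q ≥ 81`.
[cite: Weil1952FormulesExplicites, the «lemme» p. 262; Yoshida1992, Thm 1 (p. 310)] -/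
theorem weilPositivityOnChar_log_three_half_of_ge_ten (hq : 10 ≤ q) (χ : DirichletCharacter ℂ q) :
    WeilPositivityOnChar χ (Real.log 3 / 2) := by
  have hq1 : q ≠ 1 := by omega
  haveI : NeZero q := ⟨by omega⟩
  have hBq : (23 / 10 : ℝ) ≤ Real.log q := by
    have h10 : Real.log 10 ≤ Real.log q := Real.log_le_log (by norm_num) (by exact_mod_cast hq)
    rw [show (10 : ℝ) = 2 * 5 by norm_num, Real.log_mul (by norm_num) (by norm_num)] at h10
    linarith [Real.log_two_gt_d9, Real.log_five_gt_d9]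
  exact weilPositivityOnChar_log_three_half_of_curve hq1 χ hBq (by norm_num)
    (sq_nonneg _) (normSq_one_sub_char_le_four χ) le_rfl le_rfl (by norm_num) (by norm_num)

/-- **The rung `(log 3)/2` for `q ≥ 9` when `‖1 − χ(2)‖² ≥ 1`** — in particular for every
PRIMITIVE character mod `9` (`χ(2)` is then a primitive cube or sixth root of unity) — with
`B = 2.197 ≤ 2 log 3`. [cite: Weil1952FormulesExplicites, the «lemme» p. 262; Yoshida1992, Thm 1] -/
theorem weilPositivityOnChar_log_three_half_of_ge_nine (hq : 9 ≤ q) (χ : DirichletCharacter ℂ q)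
    (hχ : 1 ≤ ‖1 - χ (2 : ZMod q)‖ ^ 2) : WeilPositivityOnChar χ (Real.log 3 / 2) := by
  have hq1 : q ≠ 1 := by omega
  haveI : NeZero q := ⟨by omega⟩
  have hBq : (2.197 : ℝ) ≤ Real.log q := by
    have h9 : Real.log 9 ≤ Real.log q := Real.log_le_log (by norm_num) (by exact_mod_cast hq)
    rw [show (9 : ℝ) = 3 ^ 2 by norm_num, Real.log_pow] at h9
    push_cast at h9
    linarith [Real.log_three_gt_d9]
  exact weilPositivityOnChar_log_three_half_of_curve hq1 χ hBq (by norm_num)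
    hχ (normSq_one_sub_char_le_four χ) (by norm_num) le_rfl (by norm_num) (by norm_num)

/-- **The rung `(log 3)/2` for `q ≥ 7` when `‖1 − χ(2)‖² ≥ 3`** — in particular for the four
characters mod `7` of order `3` and `6` (`χ(2) = e^{±2πi/3}`) — with `B = 1.945 ≤ log 7`
(`7⁴ = 2401 > 2400 = 2⁵·3·5²`). [cite: Weil1952FormulesExplicites, the «lemme» p. 262; Yoshida1992, Thm 1] -/
theorem weilPositivityOnChar_log_three_half_of_ge_seven (hq : 7 ≤ q) (χ : DirichletCharacter ℂ q)
    (hχ : 3 ≤ ‖1 - χ (2 : ZMod q)‖ ^ 2) : WeilPositivityOnChar χ (Real.log 3 / 2) := by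
  have hq1 : q ≠ 1 := by omega
  haveI : NeZero q := ⟨by omega⟩
  have hBq : (1.945 : ℝ) ≤ Real.log q := by
    have h7 : Real.log 7 ≤ Real.log q := Real.log_le_log (by norm_num) (by exact_mod_cast hq)
    have h : Real.log 2400 < Real.log 2401 := Real.log_lt_log (by norm_num) (by norm_num)
    rw [show (2401 : ℝ) = 7 ^ 4 by norm_num, Real.log_pow,
      show (2400 : ℝ) = 2 ^ 5 * 3 * 5 ^ 2 by norm_num, Real.log_mul (by norm_num) (by norm_num),
      Real.log_mul (by norm_num) (by norm_num), Real.log_pow, Real.log_pow] at h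
    push_cast at h
    linarith [Real.log_two_gt_d9, Real.log_three_gt_d9, Real.log_five_gt_d9]
  exact weilPositivityOnChar_log_three_half_of_curve hq1 χ hBq (by norm_num)
    hχ (normSq_one_sub_char_le_four χ) (by norm_num) le_rfl (by norm_num) (by norm_num)

/-- **The rung `(log 3)/2` for every character of EVEN modulus `q ≥ 8`** (`2` is not a unit mod `q`,
so `χ(2) = 0`, `u = 1`: the off-curve point `σ = 1`, `Re u = 1`, with `B = 2.079 ≤ 3 log 2`).
[cite: Weil1952FormulesExplicites, the «lemme» p. 262; Yoshida1992, Thm 1] -/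
theorem weilPositivityOnChar_log_three_half_of_even_ge_eight (hq : 8 ≤ q) (heven : Even q)
    (χ : DirichletCharacter ℂ q) : WeilPositivityOnChar χ (Real.log 3 / 2) := by
  have hq1 : q ≠ 1 := by omega
  haveI : NeZero q := ⟨by omega⟩
  have hχ2 : χ (2 : ZMod q) = 0 := by
    refine χ.map_nonunit fun hunit ↦ ?_
    have hcop := (ZMod.isUnit_iff_coprime 2 q).1 (by exact_mod_cast hunit)
    obtain ⟨r, hr⟩ := heven
    have h2 : 2 ∣ q := ⟨r, by omega⟩
    have := Nat.Coprime.eq_one_of_dvd hcop h2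
    omega
  obtain ⟨hCM, hCA, hIA⟩ := log_three_half_constants
  obtain ⟨hk1, hk2⟩ := kprime_bounds
  have hBq : (2.079 : ℝ) ≤ Real.log q := by
    have h8 : Real.log 8 ≤ Real.log q := Real.log_le_log (by norm_num) (by exact_mod_cast hq)
    rw [show (8 : ℝ) = 2 ^ 3 by norm_num, Real.log_pow] at h8
    push_cast at h8
    linarith [Real.log_two_gt_d9]
  have hlog23 : Real.log 2 < Real.log 3 := Real.log_lt_log (by norm_num) (by norm_num)
  have hnum : 2 * ((0.28818 : ℝ) * (2.079 ^ 2 - 0.49012 ^ 2 * 1) +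
      2 * 2.079 * (2.079 * 0.41925 - 0.49012 * 1 * 0.41915)) ≤ 2.079 * (2.079 ^ 2 - 0.49014 ^ 2 * 1) := by
    norm_num
  have hcrit := reflection_criterion_of_bounds (k := Real.log 2 / Real.sqrt 2) (ρ := 1) (σ := 1)
    hCM hCA hIA (by norm_num) (by norm_num) (by norm_num) hk1 hk2 (by norm_num) (by norm_num)
    (by norm_num) (by nlinarith) hnum
  refine weilPositivityOnChar_transfer_reflection (B := 2.079)
    (κ := Real.log 2 / Real.sqrt 2 * ‖1 - χ (2 : ZMod q)‖) (by linarith) (le_of_eq (by ring))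
    weilPositivityOn_log_three_half hq1 χ hBq rfl ?_ rfl rfl rfl rfl ?_
  · rw [hχ2, sub_zero, norm_one, mul_one]; linarith
  · rw [hχ2, sub_zero, norm_one, mul_one, one_re]
    simpa using hcrit

/-! ## The rung `2/5` -/

/-- The rung `2/5` from the bounded curve criterion (`1 ≤ B ≤ log q`, `σ₀ ≤ ‖1 − χ(2)‖² ≤ σ₁ ≤ 4`).
[cite: Weil1952FormulesExplicites, the «lemme» p. 262; Yoshida1992, §6] -/
theorem weilPositivityOnChar_two_fifths_of_curve [NeZero q] (hq1 : q ≠ 1)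
    (χ : DirichletCharacter ℂ q) {B σ₀ σ₁ : ℝ} (hBq : B ≤ Real.log q) (hB1 : 1 ≤ B)
    (hσ₀ : σ₀ ≤ ‖1 - χ (2 : ZMod q)‖ ^ 2) (hσ₁ : ‖1 - χ (2 : ZMod q)‖ ^ 2 ≤ σ₁) (hσ₀0 : 0 ≤ σ₀)
    (hσ₁4 : σ₁ ≤ 4)
    (h0 : 2 * (0.590512 * (B ^ 2 - 0.49012 ^ 2 * σ₀) +
        2 * B * (B * 0.110122 - 0.49012 * (σ₀ / 2) * 0.110116)) ≤ B * (B ^ 2 - 0.49014 ^ 2 * σ₀))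
    (h1 : 2 * (0.590512 * (B ^ 2 - 0.49012 ^ 2 * σ₁) +
        2 * B * (B * 0.110122 - 0.49012 * (σ₁ / 2) * 0.110116)) ≤ B * (B ^ 2 - 0.49014 ^ 2 * σ₁)) :
    WeilPositivityOnChar χ (2 / 5) := by
  obtain ⟨hCM, hCA, hIA⟩ := two_fifths_constants
  obtain ⟨hk1, hk2⟩ := kprime_bounds
  set k' := Real.log 2 / Real.sqrt 2 with hk'
  set u : ℂ := 1 - χ (2 : ZMod q) with hu
  have hB : 0 < B := by linarith
  have hk0 : 0 ≤ k' := by linarith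
  have hIA0 : (0 : ℝ) ≤ (2 / 5 - (Real.log 2 - 2 / 5)) * Real.cosh (Real.log 2 / 2) / 2 +
      Real.sinh (2 / 5 - Real.log 2 / 2) := by linarith
  have hend : ∀ s : ℝ, 0 ≤ s → s ≤ 4 →
      2 * (0.590512 * (B ^ 2 - 0.49012 ^ 2 * s) +
        2 * B * (B * 0.110122 - 0.49012 * (s / 2) * 0.110116)) ≤ B * (B ^ 2 - 0.49014 ^ 2 * s) →
      2 * ((Real.sinh (Real.log 2 - 2 / 5) + (Real.log 2 - 2 / 5)) * (B ^ 2 - k' ^ 2 * s) +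
        2 * B * (B * ((Real.sinh (2 / 5) - Real.sinh (Real.log 2 - 2 / 5) +
          (2 / 5 - (Real.log 2 - 2 / 5))) / 2) -
          k' * (s / 2) * ((2 / 5 - (Real.log 2 - 2 / 5)) * Real.cosh (Real.log 2 / 2) / 2 +
            Real.sinh (2 / 5 - Real.log 2 / 2)))) ≤ B * (B ^ 2 - k' ^ 2 * s) := fun s hs0 hs4 hnum ↦
    reflection_criterion_of_bounds hCM hCA hIA (by norm_num) (by linarith) hs0 hk1 hk2
      (by norm_num) hB (by norm_num) (by nlinarith) hnum
  have hcrit := reflection_criterion_interpolate (ρ := u.re) hk0 hIA0 hB.le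
    (hend σ₀ hσ₀0 (by linarith) h0) (hend σ₁ (by linarith) hσ₁4 h1) hσ₀ hσ₁
    (normSq_one_sub_half_le_re (χ.norm_le_one _))
  have hl2 := Real.log_two_lt_d9
  have hl3 := Real.log_three_gt_d9
  refine weilPositivityOnChar_transfer_reflection (B := B) (κ := k' * ‖u‖) (by linarith) (by linarith)
    weilPositivityOn_two_fifths hq1 χ hBq (by rw [hk', hu]) ?_ rfl rfl rfl rfl ?_
  · have h2 : ‖u‖ ≤ 2 := by nlinarith [normSq_one_sub_char_le_four χ, norm_nonneg u]
    nlinarith [norm_nonneg u]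
  · rw [mul_pow]
    exact hcrit

/-- **The rung `2/5` holds for EVERY Dirichlet character of EVERY modulus `q ≥ 6`**
(`B = 1.79 ≤ log 6`; curve endpoints `σ = 0`: `2(sinh(2/5) + 2/5) = 1.6215`, and `σ = 4`).
[cite: Weil1952FormulesExplicites, the «lemme» p. 262; Yoshida1992, §6] -/
theorem weilPositivityOnChar_two_fifths_of_ge_six (hq : 6 ≤ q) (χ : DirichletCharacter ℂ q) :
    WeilPositivityOnChar χ (2 / 5) := by
  have hq1 : q ≠ 1 := by omega
  haveI : NeZero q := ⟨by omega⟩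
  have hBq : (1.79 : ℝ) ≤ Real.log q := by
    have h6 : Real.log 6 ≤ Real.log q := Real.log_le_log (by norm_num) (by exact_mod_cast hq)
    rw [show (6 : ℝ) = 2 * 3 by norm_num, Real.log_mul (by norm_num) (by norm_num)] at h6
    linarith [Real.log_two_gt_d9, Real.log_three_gt_d9]
  exact weilPositivityOnChar_two_fifths_of_curve hq1 χ hBq (by norm_num)
    (sq_nonneg _) (normSq_one_sub_char_le_four χ) le_rfl le_rfl (by norm_num) (by norm_num)

/-- **The rung `2/5` for `q ≥ 5` when `‖1 − χ(2)‖² ≥ 2`** — in particular for the three PRIMITIVE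
characters mod `5` (`χ(2) ∈ {i, −1, −i}`) — with `B = 1.609 ≤ log 5`.
[cite: Weil1952FormulesExplicites, the «lemme» p. 262; Yoshida1992, §6] -/
theorem weilPositivityOnChar_two_fifths_of_ge_five (hq : 5 ≤ q) (χ : DirichletCharacter ℂ q)
    (hχ : 2 ≤ ‖1 - χ (2 : ZMod q)‖ ^ 2) : WeilPositivityOnChar χ (2 / 5) := by
  have hq1 : q ≠ 1 := by omega
  haveI : NeZero q := ⟨by omega⟩
  have hBq : (1.609 : ℝ) ≤ Real.log q := by
    have h5 : Real.log 5 ≤ Real.log q := Real.log_le_log (by norm_num) (by exact_mod_cast hq)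
    linarith [Real.log_five_gt_d9]
  exact weilPositivityOnChar_two_fifths_of_curve hq1 χ hBq (by norm_num)
    hχ (normSq_one_sub_char_le_four χ) (by norm_num) le_rfl (by norm_num) (by norm_num)

end Summit.Ventures.WeilGRH
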